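import Literature.Computability.MetaComplexity.HeuristicClasses
import Literature.Computability.Complexity.TimeBoundsProofs
import Literature.Computability.Complexity.NondeterministicProofs
import Literature.Computability.Complexity.BPPErrorReduction
import HarnessLib

/-!
# `(BPP, 𝒟) ⊆ HeurBPP`: reduction to `BPP` error reduction (proofs)

Sibling proof file of `HeuristicClasses.lean` (D-0014: named facts `def X : Prop` are discharged
as `theorem X_holds : X`). Target: `Literature.Computability.MetaComplexity.distClass_BPP_subset_HeurBPP`
(`distClass BPP Set.univ ⊆ HeurBPP`; Bogdanov–Trevisan 2006, §2.3). Since a point-mass ensemble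
makes any single input matter, the inclusion needs a `BPP` machine whose coin error is `< 1/4`
on **every** input, i.e. error reduction below the `1/3` of `BPP = bp P`; the rest is machine
plumbing. This file

* discharges the plumbing fact `polyTimeComputable_schemeEnc_dropParams`
  (`polyTimeComputable_schemeEnc_dropParams_holds`) by an explicit two-stack machine
  `DropParamsTM.machine` (read the quadrupled sample, skip the doubled parameters, re-double the
  sample in front of the coins; linear time);
* proves that a prefix of a uniform coin string is uniform (`map_take_uniformOfFintype_vector`),
  whence the lift `RandAlg.schemeLift` of a *coin-oblivious* algorithm to scheme inputs
  `(x, 1ⁿ, 1ᵐ)` has the output distribution of the algorithm on `x` (`outputPMF_schemeLift`)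
  although its coin budget is read off the longer scheme input;
* proves `RandAlg.IsPolyTime.truncate`: the coin-truncation normal form `RandAlg.truncate`
  (`ProbabilisticClasses.lean`) is polynomial time, *given* the named machine fact
  `polyTimeComputable_boolPair_take` (a polynomial clock; not discharged here);
* proves `mem_HeurBPP_of_randAlg`: a coin-oblivious worst-case randomized decider with coin
  error `< 1/4` everywhere puts `(L, D)` in `HeurBPP` for every ensemble `D` (no input is bad);
* assembles `distClass_BPP_subset_HeurBPP_of`: the target follows from the two remaining named
  facts `exists_randAlg_error_le_of_mem_BPP` (error reduction for `BPP` to any constant,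
  Arora–Barak Thm. 7.10 / Sipser Lemma 10.5; here `ε = 1/8`) and
  `polyTimeComputable_boolPair_take`; both are now discharged
  (`Complexity/BPPErrorReduction.lean`, `Complexity/CoinTruncation.lean`), and
  `distClass_BPP_subset_HeurBPP_holds` is the resulting one-line discharge of the target.

## Proof architecture (Bogdanov–Trevisan 2006, §2.3, made explicit)

Given `L ∈ BPP`, error reduction yields `A : RandAlg (List Bool) Bool`, polynomial time with an
exact polynomial coin budget `q` and `Pr_r[A(x, r) = L(x)] ≥ 7/8` for all `x`. Its truncation
`A.truncate id` (same distribution, reads only its first `q |x|` coins) is lifted to scheme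
inputs by `run (x, n, m) r := A.run x (r ↾ q |x|)` with budget `q |⟨x, 1ⁿ, 1ᵐ⟩| ≥ q |x|`
(`ℕ`-polynomials are monotone); the lift is polynomial time by composing the machine of `A`
after the truncation clock and the parameter-dropping machine (`PolyTimeComputable.comp_holds`),
and for every `x, n, m` its coin error equals that of `A` on `x`, `≤ 1/8 < 1/4`; hence the set
of bad inputs is empty and has `Dₙ`-probability `0 ≤ 1/m`.

## References

* A. Bogdanov, L. Trevisan, *Average-Case Complexity*, Found. Trends TCS 2 (2006), §2.3
  (Def. 2.12–2.13, randomized heuristic schemes; arXiv cs/0606037 Defs. 14–15).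
* S. Arora, B. Barak, *Computational Complexity: A Modern Approach*, CUP 2009, Def. 7.3,
  §7.4.1 and Thm. 7.10 (error reduction), §0.1–§1.3 (pairing, machine constructions).
-/


/-! ## The parameter-dropping machine

On the well-formed input `boolPair (boolPair x w) r = Q(x) ++ 0011 ++ D(w) ++ 01 ++ r`
(`D` = bit doubling, `Q = D ∘ D`), the machine `DropParamsTM.machine` (stacks `inp`, `aux`;
input = output stack `inp`) runs three phases: `read` pops four symbols at a time, pushing the
common bit of a quadruple `bbbb` on `aux` and leaving on the block `0011`; `skip` pops two symbols
at a time while they are equal (the doubled parameters `D(w)`) and, on the separator `01`, pushes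
it back; `write` pops `aux` (the reversed sample) pushing each bit twice on `inp`, and halts with
`D(x) ++ 01 ++ r = boolPair x r` on `inp`, registers cleared and `aux` empty (Mathlib's
`haltList` convention). Total `2|x| + |w| + 3 ≤ |input|` steps. Behaviour on ill-formed inputs
is irrelevant (the specification quantifies over encoded inputs only). -/

namespace Literature.Computability.MetaComplexity.DropParamsTM

open Turing StateTransition Complexity MetaComplexity _root_.Computability

/-- Stacks of the machine: the input/output stack and one auxiliary stack. [folklore] -/
inductive St
  | inp
  | aux
  deriving DecidableEq, Fintype

/-- Labels (phases) of the machine. [folklore] -/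
inductive Label
  | read
  | skip
  | write
  deriving DecidableEq, Fintype

/-- States: two registers for popped symbols. [folklore] -/
abbrev State : Type := Option Bool × Option Bool

/-- Registers hold two present and equal symbols. [folklore] -/
def regEq : State → Bool
  | (some b, some b') => decide (b = b')
  | _ => false

open TM2.Stmt in
/-- The program, see the module docstring. [folklore] -/
def prog : Label → TM2.Stmt (fun _ : St => Bool) Label State
  | .read =>
    pop St.inp (fun _ a => (a, none)) <|
      pop St.inp (fun v _ => v) <|
        pop St.inp (fun v a => (v.1, a)) <|
          pop St.inp (fun v _ => v) <|
            branch regEq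
              (push St.aux (fun v => v.1.getD false) <|
                load (fun _ => (none, none)) <| goto fun _ => Label.read)
              (load (fun _ => (none, none)) <| goto fun _ => Label.skip)
  | .skip =>
    pop St.inp (fun _ a => (a, none)) <|
      pop St.inp (fun v a => (v.1, a)) <|
        branch regEq
          (load (fun _ => (none, none)) <| goto fun _ => Label.skip)
          (push St.inp (fun _ => true) <| push St.inp (fun _ => false) <|
            load (fun _ => (none, none)) <| goto fun _ => Label.write)
  | .write =>
    pop St.aux (fun _ a => (a, none)) <|
      branch (fun v => v.1.isSome)
        (push St.inp (fun v => v.1.getD false) <| push St.inp (fun v => v.1.getD false) <|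
          load (fun _ => (none, none)) <| goto fun _ => Label.write)
        (load (fun _ => (none, none)) <| halt)

/-- The machine. [folklore] -/
def machine : FinTM2 where
  K := St
  kDecidableEq := inferInstance
  k₀ := St.inp
  k₁ := St.inp
  Γ _ := Bool
  Λ := Label
  main := Label.read
  σ := State
  initialState := (none, none)
  m := prog

/-- Stack assignments. [folklore] -/
def stk (i a : List Bool) : St → List Bool
  | .inp => i
  | .aux => a

/-- The input/output stack of `stk i a`. [folklore] -/
@[simp] theorem stk_inp (i a : List Bool) : stk i a St.inp = i := rfl
/-- The auxiliary stack of `stk i a`. [folklore] -/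
@[simp] theorem stk_aux (i a : List Bool) : stk i a St.aux = a := rfl

/-- Writing the input/output stack. [folklore] -/
theorem update_stk_inp (i a l : List Bool) : Function.update (stk i a) St.inp l = stk l a := by
  funext k; cases k <;> simp

/-- Writing the auxiliary stack. [folklore] -/
theorem update_stk_aux (i a l : List Bool) : Function.update (stk i a) St.aux l = stk i l := by
  funext k; cases k <;> simp

/-- Configurations of the three phases. [folklore] -/
def cfg (lab : Label) (i a : List Bool) : machine.Cfg := ⟨some lab, (none, none), stk i a⟩

/-- The halting configuration with `i` on the input/output stack. [folklore] -/
def haltCfg (i : List Bool) : machine.Cfg := ⟨none, (none, none), stk i []⟩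

/-- The step function of the machine, with the canonical instances. [folklore] -/
theorem machine_step (c : machine.Cfg) : machine.step c = TM2.step prog c := rfl

/-- `read` on a quadrupled bit `bbbb`: push `b` on the auxiliary stack. [folklore] -/
theorem step_read_quad (b : Bool) (rest a : List Bool) :
    machine.step (cfg .read (b :: b :: b :: b :: rest) a) = some (cfg .read rest (b :: a)) := by
  rw [machine_step]
  simp [cfg, TM2.step, prog, TM2.stepAux, regEq, update_stk_inp, update_stk_aux]
  rfl

/-- `read` on the block `0011` (the doubled inner separator): switch to `skip`. [folklore] -/
theorem step_read_term (rest a : List Bool) :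
    machine.step (cfg .read (false :: false :: true :: true :: rest) a) =
      some (cfg .skip rest a) := by
  rw [machine_step]
  simp [cfg, TM2.step, prog, TM2.stepAux, regEq, update_stk_inp, update_stk_aux]
  rfl

/-- `skip` on a doubled symbol `cc`: discard it. [folklore] -/
theorem step_skip_pair (c : Bool) (rest a : List Bool) :
    machine.step (cfg .skip (c :: c :: rest) a) = some (cfg .skip rest a) := by
  rw [machine_step]
  simp [cfg, TM2.step, prog, TM2.stepAux, regEq, update_stk_inp]
  rfl

/-- `skip` on the outer separator `01`: put it back and switch to `write`. [folklore] -/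
theorem step_skip_sep (rest a : List Bool) :
    machine.step (cfg .skip (false :: true :: rest) a) =
      some (cfg .write (false :: true :: rest) a) := by
  rw [machine_step]
  simp [cfg, TM2.step, prog, TM2.stepAux, regEq, update_stk_inp]
  rfl

/-- `write` moves one bit of the auxiliary stack, doubled, onto the input/output stack.
[folklore] -/
theorem step_write_cons (b : Bool) (i a : List Bool) :
    machine.step (cfg .write i (b :: a)) = some (cfg .write (b :: b :: i) a) := by
  rw [machine_step]
  simp [cfg, TM2.step, prog, TM2.stepAux, update_stk_inp, update_stk_aux]
  rfl

/-- `write` on the empty auxiliary stack: clear the registers and halt. [folklore] -/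
theorem step_write_nil (i : List Bool) :
    machine.step (cfg .write i []) = some (haltCfg i) := by
  rw [machine_step]
  simp [cfg, TM2.step, prog, TM2.stepAux, update_stk_aux]
  rfl

/-! ### Runs of the phases -/

/-- Bit doubling `D`. [folklore] -/
def dbl (l : List Bool) : List Bool := l.flatMap fun b => [b, b]

/-- `D [] = []`. [folklore] -/
@[simp] theorem dbl_nil : dbl [] = [] := rfl
/-- `D (b :: l) = b b D(l)`. [folklore] -/
@[simp] theorem dbl_cons (b : Bool) (l : List Bool) : dbl (b :: l) = b :: b :: dbl l := rfl
/-- `D` is a monoid morphism. [folklore] -/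
theorem dbl_append (l₁ l₂ : List Bool) : dbl (l₁ ++ l₂) = dbl l₁ ++ dbl l₂ := by
  simp [dbl, List.flatMap_append]
/-- `|D(l)| = 2|l|`. [folklore] -/
@[simp] theorem length_dbl (l : List Bool) : (dbl l).length = 2 * l.length := by
  induction l with
  | nil => rfl
  | cons b l ih => simp [ih]; omega

/-- `boolPair x y = D(x) ++ 01 ++ y` (definitional). [Arora–Barak 2009, §0.1]
[cite: AroraBarak2009, §0.1] -/
theorem boolPair_eq (x y : List Bool) : boolPair x y = dbl x ++ [false, true] ++ y := rfl

/-- The `read` phase on the quadrupled sample. [folklore] -/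
theorem iterate_read (x : List Bool) :
    ∀ rest a : List Bool,
      (flip bind machine.step)^[x.length] (some (cfg .read (dbl (dbl x) ++ rest) a)) =
        some (cfg .read rest (x.reverse ++ a)) := by
  induction x with
  | nil => intro rest a; rfl
  | cons b x ih =>
    intro rest a
    rw [List.length_cons, Function.iterate_succ_apply]
    change (flip bind machine.step)^[x.length]
        (machine.step (cfg .read (b :: b :: b :: b :: (dbl (dbl x) ++ rest)) a)) = _
    rw [step_read_quad, ih]
    simp

/-- The `skip` phase on a doubled string. [folklore] -/
theorem iterate_skip (w : List Bool) :
    ∀ rest a : List Bool,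
      (flip bind machine.step)^[w.length] (some (cfg .skip (dbl w ++ rest) a)) =
        some (cfg .skip rest a) := by
  induction w with
  | nil => intro rest a; rfl
  | cons c w ih =>
    intro rest a
    rw [List.length_cons, Function.iterate_succ_apply]
    change (flip bind machine.step)^[w.length]
        (machine.step (cfg .skip (c :: c :: (dbl w ++ rest)) a)) = _
    rw [step_skip_pair, ih]

/-- The `write` phase doubles the auxiliary stack back onto the input stack and halts.
[folklore] -/
theorem iterate_write :
    ∀ a i : List Bool,
      (flip bind machine.step)^[a.length + 1] (some (cfg .write i a)) =
        some (haltCfg (dbl a.reverse ++ i))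
  | [], i => by
    simp only [List.length_nil, Nat.zero_add, Function.iterate_one, List.reverse_nil, dbl_nil,
      List.nil_append]
    exact step_write_nil i
  | b :: a, i => by
    rw [List.length_cons, Function.iterate_succ_apply]
    change (flip bind machine.step)^[a.length + 1] (machine.step (cfg .write i (b :: a))) = _
    rw [step_write_cons, iterate_write a (b :: b :: i)]
    simp [dbl_append]

/-- Total number of steps on the sample `x` and inner parameter block `w`. [folklore] -/
def steps (x w : List Bool) : ℕ := ((x.length + 1) + (w.length + 1)) + (x.length + 1)

/-- One step of the lifted step function on a live configuration. [folklore] -/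
theorem flip_bind_some (c : machine.Cfg) : flip bind machine.step (some c) = machine.step c := rfl

/-- The whole run: from `read` on `boolPair (boolPair x w) r` to the halting configuration with
`boolPair x r` on the input/output stack. [folklore] -/
theorem iterate_all (x w r : List Bool) :
    (flip bind machine.step)^[steps x w] (some (cfg .read (boolPair (boolPair x w) r) [])) =
      some (haltCfg (boolPair x r)) := by
  have hin : boolPair (boolPair x w) r =
      dbl (dbl x) ++ (false :: false :: true :: true :: (dbl w ++ (false :: true :: r))) := by
    simp [boolPair_eq, dbl_append]
  rw [hin, steps, Function.iterate_add_apply _ _ (x.length + 1), Function.iterate_succ_apply',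
    iterate_read x _ [], flip_bind_some, step_read_term,
    Function.iterate_add_apply _ (x.length + 1) (w.length + 1),
    Function.iterate_succ_apply' _ w.length, iterate_skip w _ _, flip_bind_some, step_skip_sep,
    List.append_nil]
  have := iterate_write x.reverse (false :: true :: r)
  rw [List.length_reverse] at this
  rw [this, List.reverse_reverse, boolPair_eq]
  simp

/-! ### `initList` / `haltList` and the time bound -/

/-- Mathlib's initial configuration is the `read` configuration on the input. [folklore] -/
theorem initList_eq (l : List Bool) : initList machine l = cfg .read l [] := by
  refine TM2.Cfg.mk.injEq _ _ _ _ _ _ |>.mpr ⟨rfl, rfl, ?_⟩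
  funext k
  cases k
  · exact PairFstTM.initList_stk_self machine l
  · exact PairFstTM.initList_stk_ne machine l (k := St.aux) (by rintro ⟨⟩)

/-- Mathlib's halting configuration is `haltCfg`. [folklore] -/
theorem haltList_eq (l : List Bool) : haltList machine l = haltCfg l := by
  refine TM2.Cfg.mk.injEq _ _ _ _ _ _ |>.mpr ⟨rfl, rfl, ?_⟩
  funext k
  cases k
  · exact PairFstTM.haltList_stk_self machine l
  · exact PairFstTM.haltList_stk_ne machine l (k := St.aux) (by rintro ⟨⟩)

/-- The run takes at most `|input|` steps. [folklore] -/
theorem steps_le (x w r : List Bool) : steps x w ≤ (boolPair (boolPair x w) r).length := by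
  simp only [steps, length_boolPair]
  omega

end DropParamsTM

open Turing _root_.Computability Complexity MetaComplexity DropParamsTM in
/-- The bundled machine dropping the scheme parameters. [folklore] -/
def dropParamsMachine : TM2ComputableAux Bool Bool where
  tm := DropParamsTM.machine
  inputAlphabet := Equiv.refl Bool
  outputAlphabet := Equiv.refl Bool

/-- The input alphabet identification is the identity. [folklore] -/
theorem map_inputAlphabet_symm (l : List Bool) :
    l.map dropParamsMachine.inputAlphabet.symm = l := List.map_id l

/-- The output alphabet identification is the identity. [folklore] -/
theorem map_outputAlphabet_symm (l : List Bool) :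
    l.map dropParamsMachine.outputAlphabet.symm = l := List.map_id l

open Turing _root_.Computability Complexity MetaComplexity DropParamsTM in
/-- Running time of `dropParamsMachine`: on `boolPair (boolPair x w) r` it outputs `boolPair x r`
within `|input|` steps. [folklore] -/
theorem outputsWithin_dropParamsMachine (x w r : List Bool) :
    dropParamsMachine.OutputsWithin (boolPair (boolPair x w) r) (boolPair x r)
      (boolPair (boolPair x w) r).length := by
  refine ⟨⟨⟨steps x w, ?_⟩, steps_le x w r⟩⟩
  change (flip bind machine.step)^[steps x w] (some (initList machine _)) =
    some (haltList machine _)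
  rw [map_inputAlphabet_symm, map_outputAlphabet_symm, initList_eq, haltList_eq]
  exact iterate_all x w r

open Turing _root_.Computability Complexity MetaComplexity in
/-- **Discharge of `polyTimeComputable_schemeEnc_dropParams`**: the map
`(⟨x, ⟨1ⁿ, 1ᵐ⟩⟩, r) ↦ (x, r)` between the `boolPair` encodings is computed by `dropParamsMachine`
in time `|input|` (polynomial `X`). [Arora–Barak 2009, §0.1 and §1.2 (routine machine)]
[cite: AroraBarak2009, §0.1 and §1.2] -/
theorem polyTimeComputable_schemeEnc_dropParams_holds :
    polyTimeComputable_schemeEnc_dropParams := by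
  refine ⟨Polynomial.X, dropParamsMachine, fun p => ?_⟩
  simp only [Polynomial.eval_X, schemeEnc, Function.uncurry]
  exact outputsWithin_dropParamsMachine p.1.1 _ p.2

end Literature.Computability.MetaComplexity

/-! ## Reduction of `(BPP, 𝒟) ⊆ HeurBPP` to error reduction -/

namespace Literature.Computability.MetaComplexity

open _root_.Computability

variable {α α' β β' Γ₀ Γ₁ : Type}

/-- Transport of polynomial-time computability along a re-indexing of the inputs: if `g` is
polynomial-time computable and `f`, read through the encoders `ea`, `eb`, presents the same
input and output *strings* as `g ∘ φ` through `ea'`, `eb'`, then `f` is polynomial-time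
computable (same machine, same polynomial). [folklore] -/
theorem _root_.Literature.Computability.Complexity.PolyTimeComputable.of_comp_encode {ea : α → List Γ₀} {eb : β → List Γ₁} {f : α → β}
    {ea' : α' → List Γ₀} {eb' : β' → List Γ₁} {g : α' → β'} (hg : Complexity.PolyTimeComputable ea' eb' g)
    (φ : α → α') (hea : ∀ a, ea a = ea' (φ a)) (heb : ∀ a, eb (f a) = eb' (g (φ a))) :
    Complexity.PolyTimeComputable ea eb f := by
  obtain ⟨p, M, hM⟩ := hg
  refine ⟨p, M, fun a => ?_⟩
  have h : M.OutputsWithin (ea' (φ a)) (eb' (g (φ a))) (p.eval (ea' (φ a)).length) := hM (φ a)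
  rw [← hea, ← heb] at h
  exact h

section RandAlg
open Literature.Computability.Complexity (RandAlg)
open Literature.Computability.Complexity.RandAlg

/-- **The coin-truncation normal form is polynomial time** (given the clock fact
`polyTimeComputable_boolPair_take`): compose the machine of `A` after the truncation map
`⟨u, r⟩ ↦ ⟨u, r ↾ q(|u|)⟩` (`PolyTimeComputable.comp_holds`), transported from string pairs to
`α × List Bool` along `ea`. [Arora–Barak 2009, Def. 7.3; Thm. 2.8 (proof, composition)]
[cite: AroraBarak2009, Def. 7.3] -/
theorem _root_.Literature.Computability.Complexity.RandAlg.IsPolyTime.truncate {ea : α → List Bool} {eb : β → List Γ₁} {A : RandAlg α β}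
    (hA : A.IsPolyTime ea eb) (htake : Complexity.polyTimeComputable_boolPair_take)
    (hq : ∃ q : Polynomial ℕ, ∀ n, A.coinLen n = q.eval n) :
    (A.truncate ea).IsPolyTime ea eb := by
  obtain ⟨q, hq⟩ := hq
  refine ⟨?_, hA.2⟩
  have hτ : Complexity.PolyTimeComputable (fun p : α × List Bool => Complexity.boolPair (ea p.1) p.2)
      (fun p : α × List Bool => Complexity.boolPair (ea p.1) p.2)
      (fun p : α × List Bool => (p.1, p.2.take (A.coinLen (ea p.1).length))) :=
    (htake q).of_comp_encode (fun p => (ea p.1, p.2)) (fun _ => rfl)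
      (fun p => by simp [hq, Function.uncurry])
  exact Complexity.PolyTimeComputable.comp_holds hA.1 hτ

end RandAlg

end Literature.Computability.MetaComplexity

namespace Literature.Computability.MetaComplexity

open _root_.Computability Complexity MetaComplexity
open scoped ENNReal

/-! ### Uniform coin strings: a prefix of a uniform string is uniform -/

/-- The number of bit strings of length `K` with a prescribed prefix `l` (`|l| ≤ K`) is
`2^(K-|l|)` (they correspond to their suffixes). [folklore] -/
theorem card_vector_take_eq (K : ℕ) (l : List Bool) (hl : l.length ≤ K) :
    Fintype.card {r : List.Vector Bool K // r.toList.take l.length = l} =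
      2 ^ (K - l.length) := by
  classical
  let e : {r : List.Vector Bool K // r.toList.take l.length = l} ≃
      List.Vector Bool (K - l.length) :=
    { toFun := fun r => ⟨r.1.toList.drop l.length, by simp [r.1.toList_length]⟩
      invFun := fun s => ⟨⟨l ++ s.toList, by simp [s.toList_length]; omega⟩, by simp⟩
      left_inv := by
        rintro ⟨⟨r, hr⟩, h⟩
        apply Subtype.ext; apply Subtype.ext
        change l ++ List.drop l.length r = r
        have h' : List.take l.length r = l := h
        calc l ++ List.drop l.length r = List.take l.length r ++ List.drop l.length r := by rw [h']
          _ = r := List.take_append_drop _ _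
      right_inv := by
        rintro ⟨s, hs⟩
        apply Subtype.ext
        change List.drop l.length (l ++ s) = s
        simp }
  rw [Fintype.card_congr e, card_vector, Fintype.card_bool]

/-- **A prefix of a uniform bit string is uniform**: for `k ≤ K`, the push-forward of the
uniform distribution on `{0,1}^K` under `r ↦ r↾k` is (the push-forward to `List Bool` of) the
uniform distribution on `{0,1}^k` (each string of length `k` has `2^(K-k)` extensions, of total
mass `2^(K-k)/2^K = 1/2^k`). [folklore] -/
theorem map_take_uniformOfFintype_vector {k K : ℕ} (hk : k ≤ K) :
    (PMF.uniformOfFintype (List.Vector Bool K)).map (fun r => r.toList.take k) =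
      (PMF.uniformOfFintype (List.Vector Bool k)).map List.Vector.toList := by
  classical
  ext l
  rw [← PMF.toOuterMeasure_apply_singleton, ← PMF.toOuterMeasure_apply_singleton,
    PMF.toOuterMeasure_map_apply, PMF.toOuterMeasure_map_apply,
    PMF.toOuterMeasure_uniformOfFintype_apply, PMF.toOuterMeasure_uniformOfFintype_apply,
    card_vector, card_vector, Fintype.card_bool]
  by_cases hl : l.length = k
  · subst hl
    have h1 : Fintype.card ((fun r : List.Vector Bool K => r.toList.take l.length) ⁻¹' {l}) =
        2 ^ (K - l.length) := by
      rw [← card_vector_take_eq K l hk]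
      exact Fintype.card_congr (Equiv.refl _)
    have h2 : Fintype.card ((List.Vector.toList : List.Vector Bool l.length → List Bool) ⁻¹' {l}) =
        1 := by
      rw [Fintype.card_eq_one_iff]
      refine ⟨⟨⟨l, rfl⟩, rfl⟩, ?_⟩
      rintro ⟨⟨r, hr⟩, h⟩
      apply Subtype.ext; apply Subtype.ext
      exact h
    rw [h1, h2]
    push_cast
    have h0 : (2 : ℝ≥0∞) ^ (K - l.length) ≠ 0 := pow_ne_zero _ two_ne_zero
    have htop : (2 : ℝ≥0∞) ^ (K - l.length) ≠ ∞ := ENNReal.pow_ne_top ENNReal.ofNat_ne_top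
    rw [show (2 : ℝ≥0∞) ^ K = 2 ^ (K - l.length) * 2 ^ l.length from by
      rw [← pow_add, Nat.sub_add_cancel hk], div_eq_mul_inv,
      ENNReal.mul_inv (Or.inl h0) (Or.inl htop), ← mul_assoc, ENNReal.mul_inv_cancel h0 htop,
      one_mul, one_div]
  · have h1 : ((fun r : List.Vector Bool K => r.toList.take k) ⁻¹' {l}) = ∅ := by
      ext r
      simp only [Set.mem_preimage, Set.mem_singleton_iff, Set.mem_empty_iff_false, iff_false]
      intro h
      apply hl
      rw [← h, List.length_take, r.toList_length, min_eq_left hk]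
    have h2 : ((List.Vector.toList : List.Vector Bool k → List Bool) ⁻¹' {l}) = ∅ := by
      ext r
      simp only [Set.mem_preimage, Set.mem_singleton_iff, Set.mem_empty_iff_false, iff_false]
      intro h
      exact hl (h ▸ r.toList_length)
    simp [h1, h2]

/-! ### Lifting a worst-case randomized algorithm to scheme inputs -/

end Literature.Computability.MetaComplexity

namespace Literature.Computability.Complexity.RandAlg

open MetaComplexity

variable {β : Type}

/-- The lift of a randomized algorithm on strings to scheme inputs `(x, 1ⁿ, 1ᵐ)`, ignoring the
parameters: `run (x, n, m) r := A.run x r`, with the coin budget of `A` read off the (longer)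
encoded scheme input `|⟨x, 1ⁿ, 1ᵐ⟩|`. For a coin-oblivious `A` with a monotone budget this has
the output distribution of `A` on `x` (`outputPMF_schemeLift`).
[Bogdanov–Trevisan 2006, §2.3 (a worst-case algorithm as a heuristic scheme ignoring `n, δ`)]
[cite: BogdanovTrevisan2006, §2.3] -/
def schemeLift (A : RandAlg (List Bool) β) : RandAlg (List Bool × ℕ × ℕ) β where
  run q r := A.run q.1 r
  coinLen := A.coinLen

/-- The lift runs `A` on the sample (definitional). [folklore] -/
@[simp] theorem schemeLift_run (A : RandAlg (List Bool) β) (q : List Bool × ℕ × ℕ)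
    (r : List Bool) : A.schemeLift.run q r = A.run q.1 r :=
  rfl

/-- The lift has the coin budget of `A`, as a function of the encoded input length
(definitional). [folklore] -/
@[simp] theorem schemeLift_coinLen (A : RandAlg (List Bool) β) :
    A.schemeLift.coinLen = A.coinLen :=
  rfl

/-- The sample `x` is no longer than the scheme input `⟨x, 1ⁿ, 1ᵐ⟩`. [folklore] -/
theorem length_le_length_schemeEnc (x : List Bool) (n m : ℕ) :
    x.length ≤ (schemeEnc (x, n, m)).length := by
  simp only [schemeEnc, length_boolPair]
  omega

/-- Evaluation of an `ℕ`-polynomial is monotone in the argument. [folklore] -/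
theorem _root_.Literature.Computability.MetaComplexity.polynomial_eval_mono (p : Polynomial ℕ) {a b : ℕ} (h : a ≤ b) :
    p.eval a ≤ p.eval b := by
  induction p using Polynomial.induction_on' with
  | add p q hp hq => simp only [Polynomial.eval_add]; exact Nat.add_le_add hp hq
  | monomial n c =>
    simp only [Polynomial.eval_monomial]
    exact Nat.mul_le_mul_left c (Nat.pow_le_pow_left h n)

/-- **Output distribution of the lift.** For a coin-oblivious `A` (its output depends only on
the first `coinLen |x|` coins) with an exactly polynomial, hence monotone, coin budget, the lift
to scheme inputs has on `(x, n, m)` the output distribution of `A` on `x`: the budget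
`coinLen |⟨x, 1ⁿ, 1ᵐ⟩| ≥ coinLen |x|` only appends unread uniform coins
(`map_take_uniformOfFintype_vector`). [Bogdanov–Trevisan 2006, §2.3; Arora–Barak 2009,
Def. 7.3] [cite: BogdanovTrevisan2006, §2.3] -/
theorem outputPMF_schemeLift (A : RandAlg (List Bool) β)
    (hq : ∃ q : Polynomial ℕ, ∀ n, A.coinLen n = q.eval n)
    (hobl : ∀ x r, A.run x r = A.run x (r.take (A.coinLen x.length))) (x : List Bool) (n m : ℕ) :
    A.schemeLift.outputPMF schemeEnc (x, n, m) = A.outputPMF id x := by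
  obtain ⟨q, hq⟩ := hq
  have hle : A.coinLen x.length ≤ A.coinLen (schemeEnc (x, n, m)).length := by
    rw [hq, hq]
    exact polynomial_eval_mono q (length_le_length_schemeEnc x n m)
  simp only [outputPMF, schemeLift, id]
  have h1 :
      (fun r : List.Vector Bool (A.coinLen (schemeEnc (x, n, m)).length) => A.run x r.toList) =
      (fun s : List Bool => A.run x s) ∘ fun r => r.toList.take (A.coinLen x.length) := by
    funext r
    exact hobl x r.toList
  have h2 : (fun r : List.Vector Bool (A.coinLen x.length) => A.run x r.toList) =
      (fun s : List Bool => A.run x s) ∘ List.Vector.toList := rfl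
  rw [h1, h2, ← PMF.map_comp, ← PMF.map_comp, map_take_uniformOfFintype_vector hle]

/-- Probabilities of events under the lift are those of `A` on `x` (from `outputPMF_schemeLift`).
[Bogdanov–Trevisan 2006, §2.3] [cite: BogdanovTrevisan2006, §2.3] -/
theorem pr_schemeLift (A : RandAlg (List Bool) β)
    (hq : ∃ q : Polynomial ℕ, ∀ n, A.coinLen n = q.eval n)
    (hobl : ∀ x r, A.run x r = A.run x (r.take (A.coinLen x.length))) (x : List Bool) (n m : ℕ)
    (E : Set β) : A.schemeLift.pr schemeEnc (x, n, m) E = A.pr id x E := by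
  simp only [pr, outputPMF_schemeLift A hq hobl]

/-- **The lift is polynomial time**: compose the machine of `A` after the parameter-dropping
machine (`polyTimeComputable_schemeEnc_dropParams`, `PolyTimeComputable.comp_holds`); the coin
bound is that of `A`. [Arora–Barak 2009, Thm. 2.8 (proof, composition)]
[cite: AroraBarak2009, Thm. 2.8 (proof)] -/
theorem IsPolyTime.schemeLift {Γ₁ : Type} {eb : β → List Γ₁} {A : RandAlg (List Bool) β}
    (hA : A.IsPolyTime id eb) (hdrop : polyTimeComputable_schemeEnc_dropParams) :
    A.schemeLift.IsPolyTime schemeEnc eb :=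
  ⟨PolyTimeComputable.comp_holds hA.1 hdrop, hA.2⟩

end Literature.Computability.Complexity.RandAlg

namespace Literature.Computability.MetaComplexity

open _root_.Computability Complexity MetaComplexity

/-- **No bad inputs.** A coin-oblivious probabilistic polynomial-time decider `A` for `L` with
exactly polynomial coin budget and coin error `Pr_r[A(x, r) ≠ L(x)] < 1/4` on **every** input
puts `(L, D)` in `HeurBPP` for every ensemble `D`: its lift to scheme inputs is a randomized
heuristic scheme whose set of bad inputs `{x | Pr_coins[err] ≥ 1/4}` is empty, hence of
`Dₙ`-probability `0 ≤ 1/m`. (The lift is polynomial time by the plumbing fact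
`polyTimeComputable_schemeEnc_dropParams`, discharged above.)
[Bogdanov–Trevisan 2006, §2.3, Def. 2.12–2.13 (arXiv Defs. 14–15)]
[cite: BogdanovTrevisan2006, Def. 2.12–2.13] -/
theorem mem_HeurBPP_of_randAlg
    {L : Language Bool} (D : Ensemble) (A : RandAlg (List Bool) Bool)
    (hA : A.IsPolyTime id encodeBool) (hq : ∃ q : Polynomial ℕ, ∀ n, A.coinLen n = q.eval n)
    (hobl : ∀ x r, A.run x r = A.run x (r.take (A.coinLen x.length)))
    (herr : ∀ x, A.pr id x {b | b ≠ L.boolIndicator x} < 1 / 4) :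
    (⟨L, D⟩ : DistProblem) ∈ HeurBPP := by
  refine ⟨A.schemeLift, hA.schemeLift polyTimeComputable_schemeEnc_dropParams_holds,
    fun n m hm => ?_⟩
  have hempty :
      {x | 1 / 4 ≤ A.schemeLift.pr schemeEnc (x, n, m) {b | b ≠ L.boolIndicator x}} = ∅ := by
    refine Set.eq_empty_of_forall_notMem fun x hx => ?_
    rw [Set.mem_setOf_eq, A.pr_schemeLift hq hobl] at hx
    exact absurd hx (not_le.2 (herr x))
  change D.prob n {x | 1 / 4 ≤ A.schemeLift.pr schemeEnc (x, n, m) {b | b ≠ L.boolIndicator x}} ≤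
    1 / m
  rw [hempty, Ensemble.prob, MeasureTheory.measure_empty, ENNReal.toReal_zero]
  positivity

/-- **`(BPP, 𝒟) ⊆ HeurBPP` from error reduction.** The named fact
`distClass_BPP_subset_HeurBPP` follows from `exists_randAlg_error_le_of_mem_BPP` (error
reduction for `BPP` to any constant; used at `ε = 1/8`) and the truncation-clock fact
`polyTimeComputable_boolPair_take` (both `ProbabilisticClasses.lean`), the parameter-dropping
machine being discharged in this file: amplify, truncate the coins (`RandAlg.truncate`, same
distribution, coin-oblivious, polynomial time by `IsPolyTime.truncate`), and apply
`mem_HeurBPP_of_randAlg` with coin error `1 - 7/8 = 1/8 < 1/4` (`pr_ne_eq_one_sub`).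
[Bogdanov–Trevisan 2006, §2.3; Arora–Barak 2009, §7.4.1 and Thm. 7.10]
[cite: BogdanovTrevisan2006, §2.3] -/
theorem distClass_BPP_subset_HeurBPP_of (hamp : exists_randAlg_error_le_of_mem_BPP)
    (htake : polyTimeComputable_boolPair_take) : distClass_BPP_subset_HeurBPP := by
  rintro ⟨L, D⟩ ⟨hL, -⟩
  obtain ⟨A, hA, hq, hcorrect⟩ := hamp hL (1 / 8) (by norm_num)
  refine mem_HeurBPP_of_randAlg D (A.truncate id) (hA.truncate htake hq) hq
    (fun x r => (A.truncate_run_take id x r).symm) fun x => ?_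
  rw [RandAlg.pr_truncate, RandAlg.pr_ne_eq_one_sub]
  have := hcorrect x
  linarith

/-- **`(BPP, 𝒟) ⊆ HeurBPP` (discharge of `distClass_BPP_subset_HeurBPP`).** Both hypotheses of
`distClass_BPP_subset_HeurBPP_of` are theorems of the tree: error reduction for `BPP` to any
constant, `exists_randAlg_error_le_of_mem_BPP_holds` (`Complexity/BPPErrorReduction.lean`,
iterated majority of three runs), and the coin-truncation clock
`polyTimeComputable_boolPair_take_holds` (`Complexity/CoinTruncation.lean`). The inclusion is
implicit in Bogdanov–Trevisan: a worst-case randomized polynomial-time algorithm with coin error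
`< 1/4` on every input, run on `(x; n, δ)` ignoring the parameters, is a randomized heuristic
scheme of failure probability `0` for every ensemble (§2.3, Def. 2.12–2.13).
[Bogdanov–Trevisan 2006, §2.3, Def. 2.12–2.13 (arXiv cs/0606037: Def. 14–15); Arora–Barak 2009,
§7.4.1 and Thm. 7.10] [cite: BogdanovTrevisan2006, §2.3 (Def. 2.12–2.13)] -/
theorem distClass_BPP_subset_HeurBPP_holds : distClass_BPP_subset_HeurBPP :=
  distClass_BPP_subset_HeurBPP_of exists_randAlg_error_le_of_mem_BPP_holds
    polyTimeComputable_boolPair_take_holds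

end Literature.Computability.MetaComplexity
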